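import Summits.Ventures.DiscreteObjects.Hadamard.Order25FixedEight668
import Summits.Ventures.DiscreteObjects.Hadamard.CompositeOrderStructure668B

/-!
# Hadamard 668 census, family F12 — NO signed automorphism of an H(668) has pair-order `25·q` for a prime `q ≥ 7`
# (kernel, exclusion: orders 175, 275, 325, 575, 925, 1025, 2075, 4175)

Framing: lottery ticket; floor = certified bounds/negative ranges.

Cell pub-namedobj (venture DiscreteObjects), target (H), hadamard gen 18.  The exact order-25 structure of
`Order25FixedEight668` (an element of pair-order `25` fixes exactly `8` rows, its fifth power exactly `68`) is
incompatible with a commuting element of prime order `q ≥ 7`: for a signed automorphism `(π, κ, d, e)` of an H(668)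
with `π^(25q) = κ^(25q) = 1`, `(π^(5q), κ^(5q)) ≠ (1,1)` and `(π^25, κ^25) ≠ (1,1)` (pair-order `25q`), write
`F₁ = #Fix π`, `F₅ = #Fix π⁵` on the rows.  Orbit counting for `⟨π⟩` (all in the kernel, via transversals of free
actions, `exists_orbit_reps`): `#Fix π^q = 8` with `q ∣ 8 − F₁`; `5 ∣ F₅ − F₁`; `Fix π⁵ ∩ Fix π^q = Fix π` (Bezout) and
`#Fix π^(5q) = 68 = F₅ + 8 − F₁ + 5q·n` (points of period exactly `5q`); `#Fix π^25 = F₅ + 25·m` (points of period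
exactly `25`); and `#Fix π^25` lies in the order-`q` census window.  For `q = 7`: `F₁ ∈ {1, 8}`, `F₅ ∈ {68, 33}` resp.
`{61, 26}`, and `F₅ + 25m` never lands in `{24, 38, 52, 66, 80}`; for `q ≥ 11`: `F₁ = 8`, `F₅ ∈ {68, 68 − 5q}` and
`F₅ + 25m` misses `{8,30,52} / {44} / {1,24} / {2} / {12} / {4} / {0}`.
* `free_of_proper_divisors`, `dvd_card_of_period`: a point `y` with `(κ^n) y = y` whose proper-divisor powers move it is
  free below `n`; the set of such points (for a fixed list of 'forbidden' divisors) has cardinality divisible by `n`.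
* **`no_hadamard668_signedAut_order_25q`** and the order form **`hadamard668_signedAut_not_dvd_orderOf_25q`**:
  `25·q ∤ orderOf (π, κ)` for `q ∈ {7, 11, 13, 23, 37, 41, 83, 167}`.  With `PrimeCubeOrder5` (`125 ∤`) and the prime
  spectrum: **if `25 ∣ orderOf (π, κ)` then `orderOf (π, κ) ∈ {25, 75}`** (the case `75 = 25·3` survives this
  counting: 17 orbit types).  EXCLUSION of element orders only; H(668) untouched.  Ours; no `sorry`, no definitions.
-/

namespace Summit.Ventures.DiscreteObjects.Hadamard

open Finset BigOperators Matrix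

open Literature.Combinatorics.Designs.GoethalsSeidel (IsHadamardMatrix)

variable {ι : Type*} [Fintype ι] [DecidableEq ι]

omit [Fintype ι] [DecidableEq ι] in
/-- a point with `(κ^n) y = y` which is moved by `κ^d` for every proper divisor `d` of `n` is free below `n` -/
lemma free_of_proper_divisors (κ : Equiv.Perm ι) {n : ℕ} {y : ι} (hy : (κ ^ n) y = y)
    (hd : ∀ d, d ∣ n → d < n → (κ ^ d) y ≠ y) : ∀ k, 0 < k → k < n → (κ ^ k) y ≠ y := by
  intro k hk0 hk hfix
  have h1 : Function.IsPeriodicPt κ k y := by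
    show (⇑κ)^[k] y = y
    rw [Equiv.Perm.iterate_eq_pow]; exact hfix
  have h2 : Function.IsPeriodicPt κ n y := by
    show (⇑κ)^[n] y = y
    rw [Equiv.Perm.iterate_eq_pow]; exact hy
  have h3 := h1.gcd h2
  have hg : (⇑κ)^[Nat.gcd k n] y = y := h3
  rw [Equiv.Perm.iterate_eq_pow] at hg
  refine hd (Nat.gcd k n) (Nat.gcd_dvd_right k n) ?_ hg
  exact lt_of_le_of_lt (Nat.gcd_le_left n hk0) hk

omit [Fintype ι] in
/-- **`n` divides the number of points of 'period exactly `n`'** in the sense: `(κ^n) y = y` and `κ^d` moves `y` for the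
proper divisors `d` of `n` (given as a decidable predicate `P` implying that). -/
lemma dvd_card_of_period (κ : Equiv.Perm ι) {n : ℕ} (hn : 0 < n) (P : ι → Prop) [DecidablePred P]
    (hPstab : ∀ y, P y → P (κ y)) (hPfix : ∀ y, P y → (κ ^ n) y = y)
    (hPfree : ∀ y, P y → ∀ d, d ∣ n → d < n → (κ ^ d) y ≠ y) (s : Finset ι) (hs : ∀ y, y ∈ s ↔ P y) :
    n ∣ s.card := by
  obtain ⟨T, -, hT, -⟩ := exists_orbit_reps κ hn s.card s le_rfl
    (fun y hy => (hs _).2 (hPstab y ((hs y).1 hy)))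
    (fun y hy => hPfix y ((hs y).1 hy))
    (fun y hy => free_of_proper_divisors κ (hPfix y ((hs y).1 hy)) (hPfree y ((hs y).1 hy)))
  exact ⟨T.card, hT.symm⟩

omit [Fintype ι] [DecidableEq ι] in
/-- divisors of `p·q` for primes `p, q` -/
lemma dvd_prime_mul {p q d : ℕ} (hp : p.Prime) (hq : q.Prime) (h : d ∣ p * q) :
    d = 1 ∨ d = p ∨ d = q ∨ d = p * q := by
  obtain ⟨d₁, d₂, h₁, h₂, rfl⟩ := Nat.dvd_mul.1 h
  rcases (Nat.dvd_prime hp).1 h₁ with rfl | rfl <;> rcases (Nat.dvd_prime hq).1 h₂ with rfl | rfl <;> simp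

section counting
variable (π : Equiv.Perm ι)

/-- `p ∣ #(Fix π^p ∖ Fix π)` -/
lemma dvd_card_fixed_pow_sdiff {p : ℕ} (hp : p.Prime) :
    p ∣ (univ.filter fun y => (π ^ p) y = y ∧ π y ≠ y).card := by
  refine dvd_card_of_period π hp.pos (fun y => (π ^ p) y = y ∧ π y ≠ y) ?_ (fun y hy => hy.1) ?_ _ (fun y => by simp)
  · intro y hy
    exact ⟨by rw [pow_apply_comm π p y, hy.1], fun h => hy.2 (π.injective h)⟩
  · intro y hy d hd hdlt
    rcases (Nat.dvd_prime hp).1 hd with rfl | rfl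
    · simpa using hy.2
    · omega

/-- `p² ∣ #(Fix π^(p²) ∖ Fix π^p)` -/
lemma dvd_card_fixed_sq_sdiff {p : ℕ} (hp : p.Prime) :
    p * p ∣ (univ.filter fun y => (π ^ (p * p)) y = y ∧ (π ^ p) y ≠ y).card := by
  refine dvd_card_of_period π (Nat.mul_pos hp.pos hp.pos) (fun y => (π ^ (p * p)) y = y ∧ (π ^ p) y ≠ y) ?_
    (fun y hy => hy.1) ?_ _ (fun y => by simp)
  · intro y hy
    refine ⟨by rw [pow_apply_comm π (p * p) y, hy.1], fun h => hy.2 ?_⟩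
    rw [pow_apply_comm π p y] at h
    exact π.injective h
  · intro y hy d hd hdlt hfix
    have hd' : d ∣ p ^ 2 := by rw [pow_two]; exact hd
    obtain ⟨i, hi, rfl⟩ := (Nat.dvd_prime_pow hp).1 hd'
    interval_cases i
    · exact hy.2 (by simpa using perm_pow_apply_of_fixed π (by simpa using hfix) p)
    · exact hy.2 (by simpa using hfix)
    · rw [pow_two] at hdlt; omega

/-- `p·q ∣ #(Fix π^(pq) ∖ (Fix π^p ∪ Fix π^q))` -/
lemma dvd_card_fixed_two_primes_sdiff {p q : ℕ} (hp : p.Prime) (hq : q.Prime) (hpq : p ≠ q) :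
    p * q ∣ (univ.filter fun y => (π ^ (p * q)) y = y ∧ (π ^ p) y ≠ y ∧ (π ^ q) y ≠ y).card := by
  refine dvd_card_of_period π (Nat.mul_pos hp.pos hq.pos)
    (fun y => (π ^ (p * q)) y = y ∧ (π ^ p) y ≠ y ∧ (π ^ q) y ≠ y) ?_ (fun y hy => hy.1) ?_ _ (fun y => by simp)
  · intro y hy
    refine ⟨by rw [pow_apply_comm π (p * q) y, hy.1], fun h => hy.2.1 ?_, fun h => hy.2.2 ?_⟩
    · rw [pow_apply_comm π p y] at h; exact π.injective h
    · rw [pow_apply_comm π q y] at h; exact π.injective h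
  · intro y hy d hd hdlt hfix
    rcases dvd_prime_mul hp hq hd with rfl | rfl | rfl | rfl
    · exact hy.2.1 (perm_pow_apply_of_fixed π (by simpa using hfix) p)
    · exact hy.2.1 hfix
    · exact hy.2.2 hfix
    · omega

end counting

section main
variable {H : Matrix ι ι ℤ}

/-- the order-`q` row window as an explicit finite disjunction, for the primes `q ≥ 7` of the spectrum -/
lemma rows_window_ge7 (hH : IsHadamardMatrix H) (hι : Fintype.card ι = 668)
    {π κ : Equiv.Perm ι} {d e : ι → ℤ} (haut : IsSignedAut H π κ d e) {q : ℕ}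
    (hq : q = 7 ∨ q = 11 ∨ q = 13 ∨ q = 23 ∨ q = 37 ∨ q = 41 ∨ q = 83 ∨ q = 167)
    (hπ : π ^ q = 1) (hκ : κ ^ q = 1) (hne : π ≠ 1) :
    (q = 7 ∧ ((univ.filter fun i => π i = i).card = 24 ∨ (univ.filter fun i => π i = i).card = 38 ∨
      (univ.filter fun i => π i = i).card = 52 ∨ (univ.filter fun i => π i = i).card = 66 ∨
      (univ.filter fun i => π i = i).card = 80)) ∨
    (q = 11 ∧ ((univ.filter fun i => π i = i).card = 8 ∨ (univ.filter fun i => π i = i).card = 30 ∨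
      (univ.filter fun i => π i = i).card = 52)) ∨
    (q = 13 ∧ (univ.filter fun i => π i = i).card = 44) ∨
    (q = 23 ∧ ((univ.filter fun i => π i = i).card = 1 ∨ (univ.filter fun i => π i = i).card = 24)) ∨
    (q = 37 ∧ (univ.filter fun i => π i = i).card = 2) ∨
    (q = 41 ∧ (univ.filter fun i => π i = i).card = 12) ∨
    (q = 83 ∧ (univ.filter fun i => π i = i).card = 4) ∨
    (q = 167 ∧ (univ.filter fun i => π i = i).card = 0) := by
  rcases hq with rfl | rfl | hq13
  · obtain ⟨-, hR⟩ := census7 hH hι haut hπ hκ hne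
    exact Or.inl ⟨rfl, hR⟩
  · obtain ⟨-, hR⟩ := census11 hH hι haut hπ hκ hne
    exact Or.inr (Or.inl ⟨rfl, hR⟩)
  · have hqp : q.Prime := by rcases hq13 with rfl | rfl | rfl | rfl | rfl | rfl <;> norm_num
    have hq13' : 13 ≤ q := by rcases hq13 with rfl | rfl | rfl | rfl | rfl | rfl <;> norm_num
    obtain ⟨-, h⟩ := hadamard668_signedAut_fixedRows hH hι q hqp hq13' π κ d e haut hπ hκ (Or.inl hne)
    exact Or.inr (Or.inr h)

/-- splitting `Fix σ^k`-type sets: `#{P} = #{π-fixed} + #{P ∧ π-moved}` when `π`-fixed points satisfy `P` -/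
lemma card_split_by_fixed (π : Equiv.Perm ι) (P : ι → Prop) [DecidablePred P] (hP : ∀ i, π i = i → P i) :
    (univ.filter P).card = (univ.filter fun i => π i = i).card + (univ.filter fun i => P i ∧ π i ≠ i).card := by
  have h := Finset.card_filter_add_card_filter_not (s := univ.filter P) (fun i => π i = i)
  rw [Finset.filter_filter, Finset.filter_filter] at h
  have e1 : (univ.filter fun a => P a ∧ π a = a) = univ.filter fun i => π i = i := by
    ext i; simp only [Finset.mem_filter, Finset.mem_univ, true_and]
    exact ⟨fun h => h.2, fun h => ⟨hP i h, h⟩⟩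
  rw [e1] at h
  exact h.symm

/-- **No signed automorphism of pair-order `25·q`, `q` a prime `≥ 7` of the spectrum.** -/
theorem no_hadamard668_signedAut_order_25q (hH : IsHadamardMatrix H) (hι : Fintype.card ι = 668)
    (π κ : Equiv.Perm ι) (d e : ι → ℤ) (haut : IsSignedAut H π κ d e) {q : ℕ}
    (hq : q = 7 ∨ q = 11 ∨ q = 13 ∨ q = 23 ∨ q = 37 ∨ q = 41 ∨ q = 83 ∨ q = 167)
    (hπ : π ^ (25 * q) = 1) (hκ : κ ^ (25 * q) = 1)
    (h5 : π ^ (5 * q) ≠ 1 ∨ κ ^ (5 * q) ≠ 1) (h25 : π ^ 25 ≠ 1 ∨ κ ^ 25 ≠ 1) : False := by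
  have hcard : (Fintype.card ι : ℤ) ≠ 0 := by rw [hι]; norm_num
  have hqp : q.Prime := by rcases hq with rfl | rfl | rfl | rfl | rfl | rfl | rfl | rfl <;> norm_num
  have hq5 : (5 : ℕ) ≠ q := by rcases hq with rfl | rfl | rfl | rfl | rfl | rfl | rfl | rfl <;> norm_num
  have hqodd : Odd q := hqp.odd_of_ne_two (by rcases hq with rfl | rfl | rfl | rfl | rfl | rfl | rfl | rfl <;> norm_num)
  -- the order-25 part (π^q, κ^q): exactly 8 fixed rows, fifth power 68
  have hautq := isSignedAut_pow haut q
  have hπq : (π ^ q) ^ 25 = 1 := by rw [← pow_mul, mul_comm]; exact hπ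
  have hκq : (κ ^ q) ^ 25 = 1 := by rw [← pow_mul, mul_comm]; exact hκ
  have hne5 : (π ^ q) ^ 5 ≠ 1 ∨ (κ ^ q) ^ 5 ≠ 1 := by
    rw [← pow_mul, ← pow_mul, mul_comm q 5]; exact h5
  obtain ⟨hF8, -, hF68, -⟩ := hadamard668_order25_fixed_eight hH hι (π ^ q) (κ ^ q) _ _ hautq hπq hκq hne5
  rw [← pow_mul, mul_comm q 5] at hF68
  -- the order-q part (π^25, κ^25): census window
  have haut25 := isSignedAut_pow haut 25
  have hπ25 : (π ^ 25) ^ q = 1 := by rw [← pow_mul]; exact hπ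
  have hκ25 : (κ ^ 25) ^ q = 1 := by rw [← pow_mul]; exact hκ
  have hne25 : π ^ 25 ≠ 1 := fst_pow_ne_one hH hcard haut hqodd hκ25 h25
  have hwin := rows_window_ge7 hH hι haut25 hq hπ25 hκ25 hne25
  -- orbit counting on rows
  have hc1 := dvd_card_fixed_pow_sdiff π hqp
  have hc5 := dvd_card_fixed_pow_sdiff π (by norm_num : (5 : ℕ).Prime)
  have hc25 : 25 ∣ (univ.filter fun y => (π ^ 25) y = y ∧ (π ^ 5) y ≠ y).card := by
    have h := dvd_card_fixed_sq_sdiff π (by norm_num : (5 : ℕ).Prime)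
    rwa [show (5 : ℕ) * 5 = 25 from rfl] at h
  have hc5q := dvd_card_fixed_two_primes_sdiff π (by norm_num : (5 : ℕ).Prime) hqp hq5
  -- splits
  have hsplit_q := card_split_by_fixed π (fun i => (π ^ q) i = i) (fun i h => perm_pow_apply_of_fixed π h q)
  have hsplit_5 := card_split_by_fixed π (fun i => (π ^ 5) i = i) (fun i h => perm_pow_apply_of_fixed π h 5)
  have hsplit_25 := card_split_by_fixed (π ^ 5) (fun i => (π ^ 25) i = i)
    (fun i h => by rw [show (25 : ℕ) = 5 * 5 from rfl, pow_mul]; exact perm_pow_apply_of_fixed _ h 5)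
  -- Fix π^(5q) = (Fix π^5 ∪ Fix π^q) ⊔ (period 5q);  #(Fix π^5 ∪ Fix π^q) + #Fix π = #Fix π^5 + #Fix π^q
  have hunion : (univ.filter fun i => (π ^ (5 * q)) i = i).card =
      ((univ.filter fun i => (π ^ 5) i = i) ∪ (univ.filter fun i => (π ^ q) i = i)).card +
        (univ.filter fun y => (π ^ (5 * q)) y = y ∧ (π ^ 5) y ≠ y ∧ (π ^ q) y ≠ y).card := by
    have h := Finset.card_filter_add_card_filter_not (s := univ.filter fun i => (π ^ (5 * q)) i = i)
      (fun i => (π ^ 5) i = i ∨ (π ^ q) i = i)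
    rw [Finset.filter_filter, Finset.filter_filter] at h
    have e1 : (univ.filter fun a => (π ^ (5 * q)) a = a ∧ ((π ^ 5) a = a ∨ (π ^ q) a = a)) =
        (univ.filter fun i => (π ^ 5) i = i) ∪ (univ.filter fun i => (π ^ q) i = i) := by
      ext i
      simp only [Finset.mem_filter, Finset.mem_univ, true_and, Finset.mem_union]
      constructor
      · exact fun h => h.2
      · intro h
        refine ⟨?_, h⟩
        rcases h with h | h
        · rw [pow_mul]; exact perm_pow_apply_of_fixed _ h q
        · rw [mul_comm, pow_mul]; exact perm_pow_apply_of_fixed _ h 5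
    have e2 : (univ.filter fun a => (π ^ (5 * q)) a = a ∧ ¬ ((π ^ 5) a = a ∨ (π ^ q) a = a)) =
        univ.filter fun y => (π ^ (5 * q)) y = y ∧ (π ^ 5) y ≠ y ∧ (π ^ q) y ≠ y := by
      ext i
      simp only [Finset.mem_filter, Finset.mem_univ, true_and, not_or, ne_eq]
    rw [e1, e2] at h
    exact h.symm
  have hinter : (univ.filter fun i => (π ^ 5) i = i) ∩ (univ.filter fun i => (π ^ q) i = i) =
      univ.filter fun i => π i = i := by
    ext i
    simp only [Finset.mem_inter, Finset.mem_filter, Finset.mem_univ, true_and]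
    constructor
    · exact fun h => fixed_of_fixed_pow_two_primes π (by norm_num : (5 : ℕ).Prime) hqp hq5 h.1 h.2
    · exact fun h => ⟨perm_pow_apply_of_fixed π h 5, perm_pow_apply_of_fixed π h q⟩
  have hUI := Finset.card_union_add_card_inter (univ.filter fun i => (π ^ 5) i = i)
    (univ.filter fun i => (π ^ q) i = i)
  rw [hinter] at hUI
  -- scalarise
  obtain ⟨F1, hF1⟩ : ∃ n : ℕ, n = (univ.filter fun i => π i = i).card := ⟨_, rfl⟩
  obtain ⟨F5, hF5⟩ : ∃ n : ℕ, n = (univ.filter fun i => (π ^ 5) i = i).card := ⟨_, rfl⟩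
  obtain ⟨F25, hF25⟩ : ∃ n : ℕ, n = (univ.filter fun i => (π ^ 25) i = i).card := ⟨_, rfl⟩
  obtain ⟨U, hU⟩ : ∃ n : ℕ,
      n = ((univ.filter fun i => (π ^ 5) i = i) ∪ (univ.filter fun i => (π ^ q) i = i)).card := ⟨_, rfl⟩
  obtain ⟨aq, haq⟩ := hc1
  obtain ⟨a5, ha5⟩ := hc5
  obtain ⟨m, hm⟩ := hc25
  obtain ⟨n, hn⟩ := hc5q
  rw [haq, ← hF1, hF8] at hsplit_q
  rw [ha5, ← hF1, ← hF5] at hsplit_5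
  rw [hm, ← hF5, ← hF25] at hsplit_25
  rw [hn, ← hU, hF68] at hunion
  rw [← hU, ← hF1, ← hF5, hF8] at hUI
  rw [← hF25] at hwin
  clear hF1 hF5 hF25 hU hinter hF8 hF68 hautq haut25 hπq hκq hne5 hπ25 hκ25 hne25 hπ hκ h5 h25 hcard haut hqodd
  -- arithmetic, case by case in q
  rcases hq with rfl | rfl | rfl | rfl | rfl | rfl | rfl | rfl <;>
    rcases hwin with ⟨h1, hw⟩ | ⟨h1, hw⟩ | ⟨h1, hw⟩ | ⟨h1, hw⟩ | ⟨h1, hw⟩ | ⟨h1, hw⟩ | ⟨h1, hw⟩ | ⟨h1, hw⟩ <;>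
    omega

/-- **`25·q ∤ orderOf (π, κ)`** for every signed automorphism of an H(668) and `q ∈ {7, 11, 13, 23, 37, 41, 83, 167}`. -/
theorem hadamard668_signedAut_not_dvd_orderOf_25q (hH : IsHadamardMatrix H) (hι : Fintype.card ι = 668)
    (π κ : Equiv.Perm ι) (d e : ι → ℤ) (haut : IsSignedAut H π κ d e) {q : ℕ}
    (hq : q = 7 ∨ q = 11 ∨ q = 13 ∨ q = 23 ∨ q = 37 ∨ q = 41 ∨ q = 83 ∨ q = 167)
    (hdvd : 25 * q ∣ orderOf ((π, κ) : Equiv.Perm ι × Equiv.Perm ι)) : False := by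
  set x : Equiv.Perm ι × Equiv.Perm ι := (π, κ) with hx
  have hx0 : orderOf x ≠ 0 := (orderOf_pos x).ne'
  set k := orderOf x / (25 * q) with hk
  have hord : orderOf (x ^ k) = 25 * q := orderOf_pow_orderOf_div hx0 hdvd
  have hxk : x ^ k = ((π ^ k, κ ^ k) : Equiv.Perm ι × Equiv.Perm ι) := by rw [hx, Prod.pow_mk]
  rw [hxk] at hord
  have hq7 : 7 ≤ q := by rcases hq with rfl | rfl | rfl | rfl | rfl | rfl | rfl | rfl <;> norm_num
  obtain ⟨h1, h2, h3⟩ := pow_data_of_orderOf hord (a := 5 * q) (by omega) (by omega)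
  obtain ⟨-, -, h4⟩ := pow_data_of_orderOf hord (a := 25) (by norm_num) (by omega)
  exact no_hadamard668_signedAut_order_25q hH hι (π ^ k) (κ ^ k) _ _ (isSignedAut_pow haut k) hq h1 h2 h3 h4

end main

end Summit.Ventures.DiscreteObjects.Hadamard
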